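import Literature.Geometry.Lorentzian.KerrDecayHierarchy
import HarnessLib

/-!
# DRSR Corollary 3.1, pointwise derivative estimate (31): the quantities `n_Σ̃ ψ`, `|∇_Σ̃ ψ|`
# and the reduction of `drsr_wave_derivative_decay_kerr` to (31) through the leaves

(statement group **gr.S24**; namespaces `Literature.Geometry.Lorentzian.PseudoRiemannianMetric`
(two pointwise scalar quantities of a scalar field across a hypersurface element),
`Literature.Geometry.Lorentzian.Kerr` (their Kerr–Schild evaluation), glue in
`Literature.Geometry.Lorentzian`)

`KerrWaveDecay.lean` vendors the pointwise derivative estimate (31) of Dafermos–Rodnianski–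
Shlapentokh-Rothman (*Decay for solutions of the wave equation on Kerr exterior spacetimes III*,
arXiv:1402.7034 = Ann. of Math. 183 (2016), "DRSR", §3.3, Cor. 3.1),
`sup_{Σ̃_τ ∩ {r ≤ R}} |n_Σ̃ ψ| + |∇_Σ̃ ψ| ≤ C(a₀, M, δ, R) E τ^{-2+δ}` (31),
in **local coordinate form**, as the named fact
`Literature.Geometry.Lorentzian.drsr_wave_derivative_decay_kerr`:
`∑_μ (∂_μ ψ)²(τ, y) ≤ C(M, a, δ, R, ψ) τ^{-4+2δ}` for `τ ≥ 1` at the points `(τ, y)` of the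
Kerr–Schild leaves `{t*_KS = τ} ∩ {r > r₊}` with `‖y‖ ≤ R`, for admissible waves `ψ`
(`IsAdmissibleKerrWave`). Its docstring derives that form from the printed estimate through the
identifications (i)–(iv) of the module docstring of `KerrWaveDecay.lean`; step (iv) is the
comparison, at a point of a leaf which is locally the Kerr–Schild slice, of the printed quantity
`|n_Σ̃ ψ| + |∇_Σ̃ ψ|` (normal derivative and induced-metric norm of the tangential gradient) with the
coordinate gradient. `KerrPointwiseDecay.lean` carried out the analogous reduction for the
pointwise estimate (30) through the concrete hyperboloidal foliation
`Σ̃_τ(h♯_{R₁}) = {t*_KS = τ + h♯_{R₁}(y)}` of `KerrHyperboloidalFlux.lean` (leaves terminating at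
`𝓘⁺` which *are* the Kerr–Schild slices on `{r ≤ R₁}`, `Kerr.scriHeight_eq_zero_of_radius_le`),
and left (31) aside because "its reduction needs in addition the comparison of
`|n_Σ̃ ψ| + |∇_Σ̃ ψ|` with the coordinate gradient on `{r ≤ R₁}`". This file supplies that
comparison and the reduction:

* `PseudoRiemannianMetric.unitNormalDeriv g ψ x W = dψ(W)/√(−g(W, W))` — the derivative of `ψ`
  along the unit vector `n = W/√(−g(W,W))` of a timelike `W` (the printed `n_Σ̃ ψ` when `W` is a
  future normal of `Σ̃`), and `PseudoRiemannianMetric.tangentialGradSq g ψ x W =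
  g⁻¹(dψ, dψ) + (nψ)²` — the square norm `|∇_Σ̃ ψ|²_ḡ = h^{μν} ∂_μψ ∂_νψ` of the gradient tangential
  to the hypersurface element `W^⊥`, in the induced (Riemannian) metric `ḡ`, written through the
  decomposition `g^{μν} = −n^μ n^ν + h^{μν}` of the inverse metric (definitions with bodies, for
  any pseudo-Riemannian metric of the prelude); the identity
  `(nψ)² + |∇_Σ̃ ψ|²_ḡ = 2 T[ψ](W, W)/(−g(W, W)) = 2 T[ψ](n, n) = 2 J^n_μ[ψ] n^μ`
  (`PseudoRiemannianMetric.unitNormalDeriv_sq_add_tangentialGradSq`) and the invariance of `nψ`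
  under positive rescaling of `W` (**proved**);
* on the Kerr–Schild chart with `W = V = −g♯(dt*)` (`Kerr.timeVector`, the normal of the slices
  `{t*_KS = τ}`, `g(V, V) = −1 − 2H`, unit normal `ν = V/√(1 + 2H)` = `Kerr.sliceNormal`):
  `nψ = Vψ/√(1 + 2H)` (the derivative along the prelude's future unit normal `Kerr.sliceNormal`,
  `Kerr.dcov_sliceNormal_eq_unitNormalDeriv`), `(nψ)² + |∇_Σ ψ|²_ḡ = 2 T[ψ](V, V)/(1 + 2H)`, the
  explicit form `(1 + 2H) |∇_Σ ψ|²_ḡ = (1 + 2H)|ξ⃗|² − 2H (ℓ⃗·ξ⃗)²` (`ξ⃗` the coordinate spatial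
  gradient, `ḡ = δ + 2H ℓ⃗ ⊗ ℓ⃗`, `ḡ⁻¹ = δ − (2H/(1+2H)) ℓ⃗ ⊗ ℓ⃗`), whence
  `|∇_Σ ψ|²_ḡ ≥ |ξ⃗|²/(1 + 2H) ≥ 0` for `M ≥ 0`; and on the subextremal exterior (`0 ≤ H ≤ 1`,
  `Kerr.scalarH_le_one`) the two-sided comparison with the coordinate energy density of
  `WeightedNorms.lean`, `∑_μ (∂_μψ)² ≤ 6 ((nψ)² + |∇_Σ ψ|²_ḡ) ≤ 6 (|nψ| + |∇_Σ ψ|_ḡ)²` and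
  `(nψ)² + |∇_Σ ψ|²_ḡ ≤ 30 ∑_μ (∂_μψ)²`
  (`Kerr.coordEnergyDensity_le_six_mul_sq_unitNormalDeriv_add_sqrt_tangentialGradSq`,
  `Kerr.unitNormalDeriv_sq_add_tangentialGradSq_le_thirty_mul_coordEnergyDensity`, from the
  comparison `¼ ∑_μ (∂_μψ)² ≤ T[ψ](V, V) ≤ 15 ∑_μ (∂_μψ)²` of `KerrHyperboloidalFlux.lean` /
  `KerrFluxComparison.lean`) (**proved**);
* `Literature.Geometry.Lorentzian.drsr_wave_derivative_decay_kerr_of_leaf_derivative_decay`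
  (**proved**): the named fact of `KerrWaveDecay.lean` follows from the printed estimate (31)
  read through the leaves of *any* cut-off graph foliation `h = cutoffHeight (σ M a) a R₁`
  (heights vanishing on `{r ≤ R₁}`) for the data class of `Kerr.drsr_corollary_3_1_scri_flux_decay`
  / `Kerr.drsr_corollary_3_1_scri_pointwise_decay` (admissible waves with data supported in
  `{‖y‖ ≤ R₁}`, `Kerr.HasBallData`): given `ψ` with data supported in a compact
  `K ⊆ {‖x⃗‖ ≤ ρ}`, take `R₁ = max(R₀, ρ, R + 1)`; for `‖y‖ ≤ R < R₁` the leaf point over `y` is the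
  slice point `(τ, y)`, the leaf normal there is `V` (`Kerr.leafNormal_eq_timeVector`, `dh = 0`),
  `r(τ, y) ≤ ‖y‖ ≤ R ≤ max(R, r₊ + 1)` (a radius `> r₊` as (31) requires), and the comparison
  above turns `|n_Σ̃ ψ| + |∇_Σ̃ ψ| ≤ C τ^{-2+δ}` into `∑_μ (∂_μψ)² ≤ 6 C² τ^{-4+2δ}`;
* `…_of_scri_leaf_derivative_decay` (**proved**): the instance `σ = Kerr.scriSlope`, i.e. (31) for
  the foliation `Σ̃_τ(h♯_{R₁})` terminating at `𝓘⁺` implies `drsr_wave_derivative_decay_kerr`,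
  and through `KerrWaveDecay.lean` also `drsr_wave_polynomial_decay_kerr` and
  `drsr_wave_local_energy_decay_kerr` of `BlackHoles.lean`.

Hence the local derivative-decay fact of `KerrWaveDecay.lean` rests on the printed estimate (31)
for one admissible hyperboloidal foliation, exactly as the local energy facts of `BlackHoles.lean`
rest on the printed flux estimate and the pointwise fact on (30); of the identifications (i)–(iv)
nothing remains to be trusted except the data-class argument recorded in the docstring of the
reduction (the data induced on `Σ̃₀(h♯_{R₁})` are smooth and compactly supported, so that
`E < ∞`).

## The printed proof of (31) and the next layer (not formalised here)

DRSR prove Cor. 3.1 in one sentence (§3.3, p. 14 of the arXiv text): Thms. 3.1–3.2 hold for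
admissible `Σ̃₀` of the second kind (Prop. 4.6.1 of arXiv:1010.5132), and "as a consequence of
this more general statement, the above theorems allow us to apply our 'black box' result of
[arXiv:0910.4957] (see [Schlue] and [Moschidis] for detailed treatments)". For (31) the black box
is (arXiv:0910.4957, §5: "starting from the energy decay bounds, one can obtain pointwise decay
estimates after additional commutations and applications of weighted Sobolev inequalities …
commutation with `T` and the red-shift vector field `N` and an appeal to elliptic estimates …
non-degenerate pointwise estimates of higher derivatives up to and including the horizon"; in
the detailed treatment of Moschidis, arXiv:1509.08489, §1.3.3 restating DRSR Cor. 3.1 with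
`sup_{Σ̃_τ} (|Nφ| + |∇_Σ̃ φ|) ≤ C √E τ⁻²`, Thm. 9.1 and Cor. 9.2): (E2) the improved `τ^{-4+2δ}`
decay of the non-degenerate second-order energy through the leaves (the second estimate of
Cor. 3.1 for the commuted fields, from the `r^p` hierarchy extended beyond `p = 2` by commutation,
Schlue, Anal. PDE 6 (2013); arXiv:1509.08489, Thm. 9.1 with `q = 2`, `d = 3`), upgraded to all
derivatives of order `≤ 3` on `Σ̃_τ ∩ {r ≤ R}` by the red-shift commutation and the elliptic
estimates (DRSR Thm. 3.2 (28)–(29); arXiv:0811.0354, Thm. 7.2); (S) the Sobolev inequality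
`H² ↪ L^∞` on the leaf portions `Σ̃_τ ∩ {r ≤ R}` (compact manifolds with boundary, uniformly in `τ`
by `φ_τ`-invariance). Neither layer is available in the prelude or in Mathlib (no Sobolev
embedding on domains); the printed estimate (31) for the concrete foliation therefore enters the
reduction below as an explicit hypothesis, stated with the quantities of this file, and no named
fact is introduced here. Vendoring that hypothesis as a named fact
(`Kerr.drsr_corollary_3_1_scri_derivative_decay`, companion of
`Kerr.drsr_corollary_3_1_scri_pointwise_decay`) and decomposing it into (E2) and (S) is left to a
later file; the hypothesis of `drsr_wave_derivative_decay_kerr_of_scri_leaf_derivative_decay` is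
the interface it will have to produce.

## Design choices

* **The printed quantities.** In (31), `n_Σ̃` is the future unit normal of `Σ̃_τ` and `∇_Σ̃ ψ` the
  gradient of `ψ|_{Σ̃_τ}` in the induced Riemannian metric `ḡ`. For a spacelike hypersurface
  element with timelike normal `W`, unit normal `n = W/√(−g(W,W))`, the inverse metric splits as
  `g^{μν} = −n^μ n^ν + h^{μν}` with `h` the induced inverse metric on `W^⊥ = T Σ̃`, so
  `|∇_Σ̃ ψ|²_ḡ = h^{μν} ∂_μψ ∂_νψ = g⁻¹(dψ, dψ) + (nψ)²`; this is taken as the definition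
  (`tangentialGradSq`), which needs no hypersurface, only the normal direction, and is checked on
  the Kerr–Schild slices against the explicit induced metric `ḡ = δ + 2H ℓ⃗ ⊗ ℓ⃗` (Cook 2000,
  §3.2.2; `Kerr.one_add_two_mul_scalarH_mul_tangentialGradSq_timeVector`). The un-normalised leaf
  normal `W = −g♯ d(t* − h)` is `Kerr.leafNormal` of `KerrHyperboloidalFlux.lean`; `nψ` does not
  depend on its normalisation (`unitNormalDeriv_smul`).
* **Statement at leaf points, radius bound, `τ ≥ 1`, constants**: as in
  `Kerr.drsr_corollary_3_1_scri_pointwise_decay` (`KerrPointwiseDecay.lean`, *Design choices*):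
  the supremum over `Σ̃_τ ∩ {r ≤ R}` is read at the leaf points `leafPoint h τ y` of the open
  exterior with `r ≤ R`, `R > r₊` (dropping the horizon sphere is a weakening); `C(a₀, M, δ, R) E`
  with `a₀ := |a|` is absorbed into an existential real constant depending on `(M, a, R₁, δ, R, ψ)`;
  the printed sum `|n_Σ̃ ψ| + |∇_Σ̃ ψ|` is kept un-squared, with `|∇_Σ̃ ψ| = √(|∇_Σ̃ ψ|²_ḡ)`.
* Binders use `Kerr.region a (Kerr.rPlus M a)` for `Kerr.exterior M a` (definitionally equal;
  implementation note of `KerrHyperboloidalFlux.lean`). Imports: `KerrDecayHierarchy` (for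
  `Kerr.HasBallData`; it re-exports `KerrFluxComparison`, `KerrHyperboloidalFlux` and
  `KerrWaveDecay`).

## References

* M. Dafermos, I. Rodnianski, Y. Shlapentokh-Rothman, *Decay for solutions of the wave equation
  on Kerr exterior spacetimes III: the full subextremal case `|a| < M`*, Ann. of Math. 183 (2016)
  787–913, arXiv:1402.7034: §3.1 (Thm. 3.1, the display following (23): `J^N_μ n^μ ∼ |∂ψ|²`), p. 14
  (uniform pointwise bounds of all derivatives by Sobolev on `Σ_τ`), §3.3 (admissible `Σ̃₀`;
  Cor. 3.1, estimate (31)), §3.4, §4.1 (data), p. 51 (hyperboloidal `Σ̃₀` agreeing with `Σ₀` on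
  `{r ≤ R}`) (key `DafermosRodnianskiShlapentokhrothman2014`).
* M. Dafermos, I. Rodnianski, *A new physical-space approach to decay for the wave equation with
  applications to black hole spacetimes*, XVIth ICMP (2010) 421–432, arXiv:0910.4957, §5
  (pointwise estimates), §6 (the Kerr case) (key `DafermosRodnianski2010ICMP`); *Lectures on black
  holes and linear waves*, arXiv:0811.0354, §4.1 (`J^N_μ n^μ_{Σ_τ} ∼ (∂_{t*}ψ)² + (∂_rψ)² + |∇̸ψ|²`),
  §13 = App. D (`T_{μν}`, `J^V`), Thm. 7.2 (key `DafermosRodnianski2008`); *Decay for solutions of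
  the wave equation on Kerr exterior spacetimes I–II*, arXiv:1010.5132, §4.2, §4.4, Prop. 4.5.1,
  Prop. 4.6.1 (key `DafermosRodnianski2010KerrSmallA`).
* G. Moschidis, *The `r^p`-weighted energy method of Dafermos and Rodnianski in general
  asymptotically flat spacetimes and applications*, Ann. PDE 2 (2016), arXiv:1509.08489, §1.3.3
  (restatement of DRSR Cor. 3.1), Thm. 9.1, Cor. 9.2, §9.9 (key `Moschidis2016`).
* V. Schlue, *Decay of linear waves on higher-dimensional Schwarzschild black holes*, Anal. PDE 6
  (2013) 515–600, arXiv:1012.5963 (improved interior decay) (key `Schlue2013`).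
* G. B. Cook, *Initial data for numerical relativity*, Living Rev. Relativ. 3 (2000) 5, §3.2.2
  (Kerr–Schild lapse, shift and induced metric) (key `Cook2000`).
-/

noncomputable section

open Bundle Set Filter TopologicalSpace Metric
open scoped Manifold ContDiff Topology ENNReal

namespace Literature.Geometry.Lorentzian

/-! ### Normal derivative and tangential gradient across a hypersurface element -/

section General

variable {E : Type*} [NormedAddCommGroup E] [NormedSpace ℝ E] {H : Type*} [TopologicalSpace H]
  {I : ModelWithCorners ℝ E H} {M : Type*} [TopologicalSpace M] [ChartedSpace H M]
  [IsManifold I ∞ M] {n : ℕ∞ω}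

namespace PseudoRiemannianMetric

variable (g : PseudoRiemannianMetric I n E (TangentSpace I : M → Type _))

/-- The **normal derivative** `n ψ = dψ(n)` of a scalar field `ψ` at `x` along the unit vector
`n = W / √(−g(W, W))` of a timelike vector `W` (`g(W, W) < 0`): `dψ_x(W) / √(−g_x(W, W))`. When
`W` is a future normal of a spacelike hypersurface `Σ` through `x` this is the quantity `n_Σ ψ`
of Dafermos–Rodnianski–Shlapentokh-Rothman, arXiv:1402.7034, Cor. 3.1 (31), Thm. 3.2 (29)
(`n_{Σ_τ} ψ`), and of Dafermos–Rodnianski, arXiv:0811.0354, §3.2 (`n_Σ ψ|_Σ = ψ'`, "`n_Σ` denotes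
the future unit normal of `Σ`"). It does not depend on the normalisation of `W`
(`unitNormalDeriv_smul`). **Junk value** `0` if `g(W, W) ≥ 0` (`Real.sqrt` of a non-positive
number is `0`, and `x / 0 = 0`). [cite: DafermosRodnianskiShlapentokhrothman2014, Cor. 3.1 (31)] -/
def unitNormalDeriv (ψ : M → ℝ) (x : M) (W : TangentSpace I x) : ℝ :=
  mvfderiv I ψ x W / Real.sqrt (-g.val x W W)

/-- `(n ψ)² = (dψ(W))² / (−g(W, W))` for timelike `W`. Dafermos–Rodnianski arXiv:0811.0354, §3.2,
§4.1. [folklore] -/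
lemma unitNormalDeriv_sq {ψ : M → ℝ} {x : M} {W : TangentSpace I x} (hW : g.val x W W < 0) :
    g.unitNormalDeriv ψ x W ^ 2 = (mvfderiv I ψ x W) ^ 2 / (-g.val x W W) := by
  rw [unitNormalDeriv, div_pow, Real.sq_sqrt (by linarith)]

/-- The normal derivative only depends on the direction of `W`: `n_{cW} ψ = n_W ψ` for `c > 0`
(`dψ(cW) = c dψ(W)`, `√(−g(cW, cW)) = c √(−g(W, W))`). Dafermos–Rodnianski arXiv:0811.0354,
§3.2. [folklore] -/
lemma unitNormalDeriv_smul (ψ : M → ℝ) (x : M) (W : TangentSpace I x) {c : ℝ} (hc : 0 < c) :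
    g.unitNormalDeriv ψ x (c • W) = g.unitNormalDeriv ψ x W := by
  have h1 : -g.val x (c • W) (c • W) = c ^ 2 * (-g.val x W W) := by
    simp only [map_smul, smul_eq_mul, FunLike.coe_smul, Pi.smul_apply]
    ring
  have h2 : mvfderiv I ψ x (c • W) = c * mvfderiv I ψ x W := by
    rw [map_smul, smul_eq_mul]
  rw [unitNormalDeriv, unitNormalDeriv, h1, h2, Real.sqrt_mul (sq_nonneg c), Real.sqrt_sq hc.le]
  by_cases hs : Real.sqrt (-g.val x W W) = 0
  · simp [hs]
  · rw [mul_div_mul_left _ _ hc.ne']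

variable [FiniteDimensional ℝ E]

/-- The **square norm of the tangential gradient** `|∇_Σ ψ|²_ḡ` of a scalar field `ψ` at `x`
relative to the hypersurface element `g`-orthogonal to a timelike vector `W`: with the unit normal
`n = W/√(−g(W,W))` the inverse metric decomposes as `g^{μν} = −n^μ n^ν + h^{μν}`, `h` the inverse
of the (Riemannian) metric `ḡ` induced on `W^⊥ = T_x Σ`, so that
`|∇_Σ ψ|²_ḡ = h^{μν} ∂_μψ ∂_νψ = g⁻¹(dψ, dψ) + (n ψ)²`; the right-hand side is the definition
(`gradSq` is `g⁻¹(dψ, dψ)`, `EnergyCurrents.lean`). This is the quantity `|∇_Σ̃ ψ|²` of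
Dafermos–Rodnianski–Shlapentokh-Rothman, arXiv:1402.7034, Cor. 3.1 (31) ("`∇_Σ̃ ψ`", the gradient
of the restriction of `ψ` to `Σ̃_τ` in the induced metric; Thm. 3.2 (29), `‖ψ‖_{H̊¹(Σ_τ)}`), and
with `(nψ)²` it adds up to twice the energy density `T[ψ](n, n) = J^n_μ[ψ] n^μ`
(`unitNormalDeriv_sq_add_tangentialGradSq`; Dafermos–Rodnianski, arXiv:0811.0354, §4.1:
`J^N_μ n^μ_{Σ_τ} ∼ (∂_{t*}ψ)² + (∂_rψ)² + |∇̸ψ|²`). On the Kerr–Schild slices it is the explicit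
`ḡ⁻¹`-norm of the coordinate spatial gradient
(`Kerr.one_add_two_mul_scalarH_mul_tangentialGradSq_timeVector`). **Junk** (possibly negative) if
`g(W, W) ≥ 0`. [cite: DafermosRodnianskiShlapentokhrothman2014, Cor. 3.1 (31)] -/
def tangentialGradSq (ψ : M → ℝ) (x : M) (W : TangentSpace I x) : ℝ :=
  g.gradSq ψ x + g.unitNormalDeriv ψ x W ^ 2

/-- `|∇_Σ ψ|²_ḡ` only depends on the direction of `W` (`tangentialGradSq (c • W) =
tangentialGradSq W` for `c > 0`), by `unitNormalDeriv_smul`. [folklore] -/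
lemma tangentialGradSq_smul (ψ : M → ℝ) (x : M) (W : TangentSpace I x) {c : ℝ} (hc : 0 < c) :
    g.tangentialGradSq ψ x (c • W) = g.tangentialGradSq ψ x W := by
  rw [tangentialGradSq, tangentialGradSq, g.unitNormalDeriv_smul ψ x W hc]

/-- **The energy density through a hypersurface element in terms of normal and tangential
derivatives**: for timelike `W` with unit vector `n = W/√(−g(W,W))`,
`(n ψ)² + |∇_Σ ψ|²_ḡ = 2 T[ψ](W, W) / (−g(W, W)) = 2 T[ψ](n, n) = 2 J^n_μ[ψ] n^μ`
(`T[ψ](W, W) = (Wψ)² − ½ g(W, W) g⁻¹(dψ, dψ)`, `PseudoRiemannianMetric.stressEnergy_apply`). This is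
the pointwise content of the comparability `J^N_μ n^μ_Σ ∼ (∂_{t*}ψ)² + (∂_rψ)² + |∇̸ψ|²` of
Dafermos–Rodnianski, arXiv:0811.0354, §4.1, and of `∫_{Σ_τ} J^N_μ n^μ ∼ ‖∇_{Σ_τ}ψ‖² + ‖n_{Σ_τ}ψ‖²`,
DRSR arXiv:1402.7034, Thm. 3.2 (29) with `j = 1`. [cite: DafermosRodnianski2008, §4.1] -/
lemma unitNormalDeriv_sq_add_tangentialGradSq {ψ : M → ℝ} {x : M} {W : TangentSpace I x}
    (hW : g.val x W W < 0) :
    g.unitNormalDeriv ψ x W ^ 2 + g.tangentialGradSq ψ x W =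
      2 * g.stressEnergy ψ x W W / (-g.val x W W) := by
  have hs : g.val x W W ≠ 0 := hW.ne
  rw [tangentialGradSq, g.unitNormalDeriv_sq hW, stressEnergy_apply]
  field_simp
  ring

end PseudoRiemannianMetric

end General

namespace Kerr

variable [Facts]

/-! ### Evaluation on the Kerr–Schild chart for the slice normal `V = −g♯(dt*)` -/

/-- On the Kerr–Schild chart the normal derivative for `W = V = −g♯(dt*)` is
`n ψ = Vψ / √(1 + 2H)` (`g(V, V) = −1 − 2H`, `Kerr.bilin_timeVector_timeVector`; the unit normal of
the slices `{t* = τ}` is `ν = V/√(1 + 2H)`, `Kerr.sliceNormal`). Cook 2000, §3.2.2 (lapse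
`α = (1 + 2H)^{-1/2}`); Dafermos–Rodnianski arXiv:0811.0354, §5.1. [cite: Cook2000, §3.2.2] -/
theorem unitNormalDeriv_timeVector (M a r₀ : ℝ) (ψ : region a r₀ → ℝ) (x : region a r₀) :
    (smoothMetric M a r₀).unitNormalDeriv ψ x (timeVector M a x.1) =
      dcov ψ x (timeVector M a x.1) / Real.sqrt (1 + 2 * scalarH M a x.1) := by
  have hx : 0 < radius a x.1 := radius_pos_of_mem_region x.2
  have hVV : (smoothMetric M a r₀).val x (timeVector M a x.1) (timeVector M a x.1) =
      -1 - 2 * scalarH M a x.1 := by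
    rw [smoothMetric_val]
    exact bilin_timeVector_timeVector hx
  rw [PseudoRiemannianMetric.unitNormalDeriv, hVV, mvfderiv_apply_eq_dcov]
  congr 2
  ring

/-- Consistency with the prelude's unit normal: on the slice `{t* = 0}` the normal derivative for
`W = V` is the derivative along the future unit normal `ν = (√(1 + 2H))⁻¹ • V = Kerr.sliceNormal`
of `KerrData.lean`, `dψ(ν) = n ψ`. Cook 2000, §3.2.2. [cite: Cook2000, §3.2.2] -/
theorem dcov_sliceNormal_eq_unitNormalDeriv (M a r₀ : ℝ) (ψ : region a r₀ → ℝ) (y : slice a r₀) :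
    dcov ψ (sliceEmbed a r₀ y) (sliceNormal M a r₀ y) =
      (smoothMetric M a r₀).unitNormalDeriv ψ (sliceEmbed a r₀ y)
        (timeVector M a (E4.ofTimeSpace 0 y)) := by
  rw [sliceNormal_apply, map_smul, smul_eq_mul]
  have h := unitNormalDeriv_timeVector M a r₀ ψ (sliceEmbed a r₀ y)
  rw [coe_sliceEmbed] at h
  rw [h, div_eq_inv_mul]

/-- **`(n ψ)² + |∇_Σ ψ|²_ḡ = 2 T[ψ](V, V) / (1 + 2H)` on the Kerr–Schild chart** (`M ≥ 0`, so that
`1 + 2H > 0`), for the slice normal `V = −g♯(dt*)`: the printed local quantity of DRSR's (31),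
squared, is the `V`-energy density `T[ψ](V, V)` of `KerrFluxComparison.lean` up to the lapse factor
`1 + 2H ∈ [1, 3]`. DRSR arXiv:1402.7034, §3.1 (display following (23)) and Cor. 3.1 (31);
Dafermos–Rodnianski arXiv:0811.0354, §4.1. [cite: DafermosRodnianskiShlapentokhrothman2014, §3.1 display following (23)] -/
theorem unitNormalDeriv_sq_add_tangentialGradSq_timeVector {M : ℝ} (hM : 0 ≤ M) (a r₀ : ℝ)
    (ψ : region a r₀ → ℝ) (x : region a r₀) :
    (smoothMetric M a r₀).unitNormalDeriv ψ x (timeVector M a x.1) ^ 2 +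
        (smoothMetric M a r₀).tangentialGradSq ψ x (timeVector M a x.1) =
      2 * (smoothMetric M a r₀).stressEnergy ψ x (timeVector M a x.1) (timeVector M a x.1) /
        (1 + 2 * scalarH M a x.1) := by
  have hx : 0 < radius a x.1 := radius_pos_of_mem_region x.2
  have hH : 0 ≤ scalarH M a x.1 := scalarH_nonneg hM a x.1
  have hVV : (smoothMetric M a r₀).val x (timeVector M a x.1) (timeVector M a x.1) =
      -1 - 2 * scalarH M a x.1 := by
    rw [smoothMetric_val]
    exact bilin_timeVector_timeVector hx
  rw [PseudoRiemannianMetric.unitNormalDeriv_sq_add_tangentialGradSq _ (by rw [hVV]; linarith),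
    hVV]
  congr 1
  ring

/-- **The tangential gradient on a Kerr–Schild slice in components.** With `ξ⃗ = (∂₁ψ, ∂₂ψ, ∂₃ψ)`
the coordinate spatial gradient and `q = ℓ⃗ · ξ⃗`:
`(1 + 2H) |∇_Σ ψ|²_ḡ = (1 + 2H) |ξ⃗|² − 2H q²`, i.e. `|∇_Σ ψ|²_ḡ = ḡ^{ij} ξ_i ξ_j` for the inverse
`ḡ⁻¹ = δ − (2H/(1 + 2H)) ℓ⃗ ⊗ ℓ⃗` (Sherman–Morrison, `|ℓ⃗| = 1`) of the induced metric
`ḡ = δ + 2H ℓ⃗ ⊗ ℓ⃗` of the slices `{t* = τ}` — confirming that `tangentialGradSq` for `W = V` is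
the induced-metric norm of the tangential gradient. From `Kerr.two_mul_stressEnergy_timeVector`
and `(1 + 2H)(nψ)² = (Vψ)² = ((1 + 2H)∂₀ψ − 2Hq)²`. Cook 2000, §3.2.2, (55) (`γ_{ij} = δ_{ij} +
2H ℓ_i ℓ_j`); DRSR arXiv:1402.7034, Thm. 3.2 (29). [cite: Cook2000, §3.2.2 (55)] -/
theorem one_add_two_mul_scalarH_mul_tangentialGradSq_timeVector {M : ℝ} (hM : 0 ≤ M) (a r₀ : ℝ)
    (ψ : region a r₀ → ℝ) (x : region a r₀) :
    (1 + 2 * scalarH M a x.1) * (smoothMetric M a r₀).tangentialGradSq ψ x (timeVector M a x.1) =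
      (1 + 2 * scalarH M a x.1) *
          (dcov ψ x (E4.basisVector 1) ^ 2 + dcov ψ x (E4.basisVector 2) ^ 2 +
            dcov ψ x (E4.basisVector 3) ^ 2) -
        2 * scalarH M a x.1 *
          (nullCovectorFun a x.1 1 * dcov ψ x (E4.basisVector 1) +
              nullCovectorFun a x.1 2 * dcov ψ x (E4.basisVector 2) +
              nullCovectorFun a x.1 3 * dcov ψ x (E4.basisVector 3)) ^ 2 := by
  have hx : 0 < radius a x.1 := radius_pos_of_mem_region x.2
  have hH : 0 ≤ scalarH M a x.1 := scalarH_nonneg hM a x.1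
  have hpos : 0 < 1 + 2 * scalarH M a x.1 := by linarith
  have hid := unitNormalDeriv_sq_add_tangentialGradSq_timeVector hM a r₀ ψ x
  have h2T := two_mul_stressEnergy_timeVector M a r₀ ψ x
  have hnd : (1 + 2 * scalarH M a x.1) *
      (smoothMetric M a r₀).unitNormalDeriv ψ x (timeVector M a x.1) ^ 2 =
        dcov ψ x (timeVector M a x.1) ^ 2 := by
    rw [unitNormalDeriv_timeVector, div_pow, Real.sq_sqrt hpos.le]
    field_simp
  have hV : dcov ψ x (timeVector M a x.1) =
      (1 + 2 * scalarH M a x.1) * dcov ψ x (E4.basisVector 0) -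
        2 * scalarH M a x.1 *
          (nullCovectorFun a x.1 1 * dcov ψ x (E4.basisVector 1) +
            nullCovectorFun a x.1 2 * dcov ψ x (E4.basisVector 2) +
            nullCovectorFun a x.1 3 * dcov ψ x (E4.basisVector 3)) := by
    rw [dcov_apply_timeVector, dcov_apply_nullVector]
    ring
  -- `(1+2H)·(nd² + tg) = 2T`
  have hsum : (1 + 2 * scalarH M a x.1) *
      ((smoothMetric M a r₀).unitNormalDeriv ψ x (timeVector M a x.1) ^ 2 +
        (smoothMetric M a r₀).tangentialGradSq ψ x (timeVector M a x.1)) =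
      2 * (smoothMetric M a r₀).stressEnergy ψ x (timeVector M a x.1) (timeVector M a x.1) := by
    rw [hid]
    field_simp
  rw [mul_add, hnd, h2T, hV] at hsum
  linarith

/-- For `M ≥ 0` the tangential gradient on a Kerr–Schild slice controls the coordinate spatial
gradient: `|ξ⃗|² ≤ (1 + 2H) |∇_Σ ψ|²_ḡ` (`q² ≤ |ξ⃗|²` since `|ℓ⃗| = 1`, in
`one_add_two_mul_scalarH_mul_tangentialGradSq_timeVector`); in particular `|∇_Σ ψ|²_ḡ ≥ 0` there.
Cook 2000, §3.2.2; DRSR arXiv:1402.7034, Thm. 3.2 (29). [folklore] -/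
theorem sum_sq_spatial_dcov_le_tangentialGradSq_timeVector {M : ℝ} (hM : 0 ≤ M) (a r₀ : ℝ)
    (ψ : region a r₀ → ℝ) (x : region a r₀) :
    dcov ψ x (E4.basisVector 1) ^ 2 + dcov ψ x (E4.basisVector 2) ^ 2 +
        dcov ψ x (E4.basisVector 3) ^ 2 ≤
      (1 + 2 * scalarH M a x.1) * (smoothMetric M a r₀).tangentialGradSq ψ x (timeVector M a x.1) := by
  have hx : 0 < radius a x.1 := radius_pos_of_mem_region x.2
  have hH : 0 ≤ scalarH M a x.1 := scalarH_nonneg hM a x.1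
  rw [one_add_two_mul_scalarH_mul_tangentialGradSq_timeVector hM]
  set p₁ := dcov ψ x (E4.basisVector 1)
  set p₂ := dcov ψ x (E4.basisVector 2)
  set p₃ := dcov ψ x (E4.basisVector 3)
  set l₁ := nullCovectorFun a x.1 1
  set l₂ := nullCovectorFun a x.1 2
  set l₃ := nullCovectorFun a x.1 3
  have hnull : l₁ ^ 2 + l₂ ^ 2 + l₃ ^ 2 = 1 := sum_sq_nullCovectorFun hx
  have hS : (l₁ * p₁ + l₂ * p₂ + l₃ * p₃) ^ 2 ≤ p₁ ^ 2 + p₂ ^ 2 + p₃ ^ 2 := by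
    nlinarith [sq_nonneg (l₁ * p₂ - l₂ * p₁), sq_nonneg (l₁ * p₃ - l₃ * p₁),
      sq_nonneg (l₂ * p₃ - l₃ * p₂)]
  nlinarith [mul_nonneg hH (sub_nonneg.2 hS)]

/-- `|∇_Σ ψ|²_ḡ ≥ 0` on the Kerr–Schild slices for `M ≥ 0` (the induced metric is Riemannian).
Cook 2000, §3.2.2. [folklore] -/
theorem tangentialGradSq_timeVector_nonneg {M : ℝ} (hM : 0 ≤ M) (a r₀ : ℝ)
    (ψ : region a r₀ → ℝ) (x : region a r₀) :
    0 ≤ (smoothMetric M a r₀).tangentialGradSq ψ x (timeVector M a x.1) := by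
  have hH : 0 ≤ scalarH M a x.1 := scalarH_nonneg hM a x.1
  have hpos : 0 < 1 + 2 * scalarH M a x.1 := by linarith
  have h := sum_sq_spatial_dcov_le_tangentialGradSq_timeVector hM a r₀ ψ x
  have h0 : 0 ≤ dcov ψ x (E4.basisVector 1) ^ 2 + dcov ψ x (E4.basisVector 2) ^ 2 +
      dcov ψ x (E4.basisVector 3) ^ 2 := by positivity
  exact (mul_nonneg_iff_of_pos_left hpos).mp (h0.trans h)

/-! ### Comparison with the coordinate energy density on the subextremal exterior -/

/-- **The printed quantity of (31) controls the coordinate gradient**: on the subextremal exterior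
`{r > r₊}`, `|a| < M` (where `0 ≤ H ≤ 1`, `Kerr.scalarH_le_one`),
`∑_μ (∂_μψ)² ≤ 6 ((nψ)² + |∇_Σ ψ|²_ḡ)` for the slice normal `V`: indeed
`∑_μ (∂_μψ)² ≤ 4 T[ψ](V, V)` (`Kerr.coordEnergyDensity_le_four_mul_stressEnergy`) and
`2 T[ψ](V, V) = (1 + 2H)((nψ)² + |∇_Σψ|²_ḡ) ≤ 3 ((nψ)² + |∇_Σψ|²_ḡ)`. This is step (iv) of the module
docstring of `KerrWaveDecay.lean` (comparability of `(n_Σ̃ ψ, ∇_Σ̃ ψ)` with the coordinate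
gradient, "constants depending only on `(M, a, R₁)`" — here absolute). DRSR arXiv:1402.7034, §3.1
(display following (23)), Cor. 3.1 (31). [cite: DafermosRodnianskiShlapentokhrothman2014, §3.1 display following (23)] -/
theorem coordEnergyDensity_le_six_mul_unitNormalDeriv_sq_add_tangentialGradSq {M a : ℝ}
    (hMa : IsSubextremal M a) (ψ : region a (rPlus M a) → ℝ) (x : region a (rPlus M a)) :
    coordEnergyDensity (region a (rPlus M a)) ψ x.1 ≤
      6 * ((smoothMetric M a (rPlus M a)).unitNormalDeriv ψ x (timeVector M a x.1) ^ 2 +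
        (smoothMetric M a (rPlus M a)).tangentialGradSq ψ x (timeVector M a x.1)) := by
  have hH0 : 0 ≤ scalarH M a x.1 := scalarH_nonneg hMa.pos.le a x.1
  have hH1 : scalarH M a x.1 ≤ 1 := scalarH_le_one hMa x.2
  have hpos : 0 < 1 + 2 * scalarH M a x.1 := by linarith
  have h4 := coordEnergyDensity_le_four_mul_stressEnergy hMa.pos.le ψ x
  have h0 := coordEnergyDensity_nonneg (region a (rPlus M a)) ψ x.1
  rw [unitNormalDeriv_sq_add_tangentialGradSq_timeVector hMa.pos.le]
  set T := (smoothMetric M a (rPlus M a)).stressEnergy ψ x (timeVector M a x.1) (timeVector M a x.1)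
  have hT : 0 ≤ T := by linarith
  calc coordEnergyDensity (region a (rPlus M a)) ψ x.1 ≤ 4 * T := h4
    _ ≤ 6 * (2 * T / (1 + 2 * scalarH M a x.1)) := by
        rw [mul_div_assoc', le_div_iff₀ hpos]
        nlinarith [mul_nonneg hT (sub_nonneg.2 hH1)]

/-- **Converse comparison**: on the subextremal exterior,
`(nψ)² + |∇_Σ ψ|²_ḡ ≤ 30 ∑_μ (∂_μψ)²` for the slice normal `V` (`2 T[ψ](V, V) ≤ 30 ∑_μ (∂_μψ)²`,
`Kerr.stressEnergy_timeVector_le_sum_sq_of_isSubextremal`, and `1 + 2H ≥ 1`). With the previous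
lemma: the printed quantity of (31), squared, and the coordinate energy density are comparable on
`{r > r₊}` with absolute constants ("with constants `c`, `C` not depending on `ψ`", DRSR
arXiv:1402.7034, §3.1, display following (23)). [cite: DafermosRodnianskiShlapentokhrothman2014, §3.1 display following (23)] -/
theorem unitNormalDeriv_sq_add_tangentialGradSq_le_thirty_mul_coordEnergyDensity {M a : ℝ}
    (hMa : IsSubextremal M a) (ψ : region a (rPlus M a) → ℝ) (x : region a (rPlus M a)) :
    (smoothMetric M a (rPlus M a)).unitNormalDeriv ψ x (timeVector M a x.1) ^ 2 +
        (smoothMetric M a (rPlus M a)).tangentialGradSq ψ x (timeVector M a x.1) ≤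
      30 * coordEnergyDensity (region a (rPlus M a)) ψ x.1 := by
  have hH0 : 0 ≤ scalarH M a x.1 := scalarH_nonneg hMa.pos.le a x.1
  have hpos : 0 < 1 + 2 * scalarH M a x.1 := by linarith
  have h15 := stressEnergy_timeVector_le_sum_sq_of_isSubextremal hMa ψ x
  rw [← coordEnergyDensity_eq_sum_sq_mvfderiv] at h15
  have h0 := coordEnergyDensity_nonneg (region a (rPlus M a)) ψ x.1
  rw [unitNormalDeriv_sq_add_tangentialGradSq_timeVector hMa.pos.le, div_le_iff₀ hpos]
  nlinarith [mul_nonneg h0 hH0]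

/-- **Squared-sum form used by the reduction**: on the subextremal exterior,
`∑_μ (∂_μψ)²(x) ≤ 6 (|nψ| + |∇_Σ ψ|_ḡ)²(x)` with `|∇_Σ ψ|_ḡ = √(|∇_Σ ψ|²_ḡ)`, for the slice normal
`V` at `x` (from the previous lemma and `s ≤ (√s)²`, `(nψ)² + (√s)² ≤ (|nψ| + √s)²`). The point is
given as `x : E4` with a membership proof so that the statement matches the leaf-point form of
(31). DRSR arXiv:1402.7034, §3.1 (display following (23)), Cor. 3.1 (31). [cite: DafermosRodnianskiShlapentokhrothman2014, Cor. 3.1 (31)] -/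
theorem coordEnergyDensity_le_six_mul_sq_unitNormalDeriv_add_sqrt_tangentialGradSq {M a : ℝ}
    (hMa : IsSubextremal M a) (ψ : region a (rPlus M a) → ℝ) {x : E4}
    (hx : x ∈ region a (rPlus M a)) :
    coordEnergyDensity (region a (rPlus M a)) ψ x ≤
      6 * (|(smoothMetric M a (rPlus M a)).unitNormalDeriv ψ ⟨x, hx⟩ (timeVector M a x)| +
        Real.sqrt ((smoothMetric M a (rPlus M a)).tangentialGradSq ψ ⟨x, hx⟩ (timeVector M a x))) ^ 2 := by
  have h := coordEnergyDensity_le_six_mul_unitNormalDeriv_sq_add_tangentialGradSq hMa ψ ⟨x, hx⟩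
  refine h.trans (mul_le_mul_of_nonneg_left ?_ (by norm_num))
  set nd := (smoothMetric M a (rPlus M a)).unitNormalDeriv ψ ⟨x, hx⟩ (timeVector M a x)
  set tg := (smoothMetric M a (rPlus M a)).tangentialGradSq ψ ⟨x, hx⟩ (timeVector M a x)
  have h1 : tg ≤ Real.sqrt tg ^ 2 := by
    rcases le_or_gt 0 tg with htg | htg
    · rw [Real.sq_sqrt htg]
    · exact htg.le.trans (sq_nonneg _)
  have h2 : nd ^ 2 = |nd| ^ 2 := (sq_abs nd).symm
  nlinarith [mul_nonneg (abs_nonneg nd) (Real.sqrt_nonneg tg)]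

end Kerr

/-! ### Reduction of the coordinate derivative decay to (31) through the leaves -/

/-- **Reduction of DRSR's pointwise derivative decay (coordinate form) to the printed estimate
(31) through the leaves of a cut-off graph foliation.** Let `σ M a : ℝ → ℝ` be any family of far
slopes and `h = Kerr.cutoffHeight (σ M a) a R₁` the associated heights (vanishing on `{r ≤ R₁}`),
with leaves `Σ̃_τ(h) = {t*_KS = τ + h(y)}` and un-normalised future leaf normal
`W = −g♯ d(t* − h) = Kerr.leafNormal M a h` (`KerrHyperboloidalFlux.lean`). **Hypothesis** (the
printed (31), DRSR arXiv:1402.7034, §3.3, Cor. 3.1, for this foliation and the data class of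
`Kerr.drsr_corollary_3_1_scri_pointwise_decay`): for `|a| < M` there is `R₀ > 0` such that for
all `R₁ ≥ R₀`, all admissible waves `ψ` with data supported in `{‖y‖ ≤ R₁}` (`Kerr.HasBallData`),
all `δ > 0` and all `R > r₊` there is `C` with
`|n_Σ̃ ψ|(p) + |∇_Σ̃ ψ|_ḡ(p) ≤ C τ^{-2+δ}` (`τ ≥ 1`) at the exterior leaf points
`p = Kerr.leafPoint h τ y` with `r(p) ≤ R`, where `n_Σ̃ ψ = unitNormalDeriv … W` and
`|∇_Σ̃ ψ|_ḡ = √(tangentialGradSq … W)` for the leaf normal `W` at `p` — i.e.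
`sup_{Σ̃_τ(h) ∩ {r₊ < r ≤ R}} |n_Σ̃ ψ| + |∇_Σ̃ ψ| ≤ C τ^{-2+δ}`, the printed
`sup_{Σ̃_τ ∩ {r ≤ R}} |n_Σ̃ ψ| + |∇_Σ̃ ψ| ≤ C(a₀, M, δ, R) E τ^{-2+δ}` with `a₀ := |a|`, `C E`
absorbed into the existential constant, the horizon sphere dropped from the supremum, and `E < ∞`
because the data induced on `Σ̃₀(h)` by an admissible wave with ball data are smooth and compactly
supported when `Σ̃₀(h)` is an admissible hyperboloidal hypersurface (derivation (i)–(iv) in the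
docstring of `Kerr.drsr_corollary_3_1_scri_pointwise_decay`, verbatim with (30) replaced by (31)).
**Conclusion**: `Literature.Geometry.Lorentzian.drsr_wave_derivative_decay_kerr`
(`KerrWaveDecay.lean`: `∑_μ (∂_μψ)²(τ, y) ≤ C' τ^{-4+2δ}` at the slice points with `‖y‖ ≤ R`,
`τ ≥ 1`). **Proof**: given `ψ` with data supported in a compact `K ⊆ {‖x⃗‖ ≤ ρ}`
(`exists_spatialNorm_le_of_isCompact`) and a coordinate radius `R`, choose
`R₁ = max(R₀, ρ, R + 1)`; for `‖y‖ ≤ R < R₁` the leaf `Σ̃_τ(h)` is the Kerr–Schild slice `{t* = τ}`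
near the point over `y` (`Kerr.cutoffHeight_eq_zero_of_radius_le`, `Kerr.leafPoint_of_eq_zero`)
with normal `W = V` (`Kerr.leafNormal_eq_timeVector`, `Kerr.fderiv_cutoffHeight_eq_zero`), and
`r(τ, y) ≤ ‖y‖ ≤ R ≤ max(R, r₊ + 1)` (`Kerr.radius_ofTimeSpace_le_norm`), a radius bound `> r₊` as
required by (31); there `∑_μ (∂_μψ)² ≤ 6 (|nψ| + |∇_Σψ|_ḡ)² ≤ 6 C² τ^{2(-2+δ)}`
(`Kerr.coordEnergyDensity_le_six_mul_sq_unitNormalDeriv_add_sqrt_tangentialGradSq`). DRSR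
arXiv:1402.7034, §3.3, Cor. 3.1 (31) and p. 51. [cite: DafermosRodnianskiShlapentokhrothman2014, Cor. 3.1 (31) and p. 51] -/
theorem drsr_wave_derivative_decay_kerr_of_leaf_derivative_decay (σ : ℝ → ℝ → ℝ → ℝ)
    (h31 : ∀ [Kerr.Facts] [Kerr.SliceFacts] (M a : ℝ), Kerr.IsSubextremal M a →
      ∃ R₀ : ℝ, 0 < R₀ ∧ ∀ R₁ : ℝ, R₀ ≤ R₁ →
        ∀ ψ : Kerr.region a (Kerr.rPlus M a) → ℝ, IsAdmissibleKerrWave M a ψ →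
          Kerr.HasBallData M a R₁ ψ → ∀ δ : ℝ, 0 < δ → ∀ R : ℝ, Kerr.rPlus M a < R →
            ∃ C : ℝ, ∀ τ : ℝ, 1 ≤ τ →
              ∀ (y : E3) (hy : Kerr.leafPoint (Kerr.cutoffHeight (σ M a) a R₁) τ y ∈
                  Kerr.region a (Kerr.rPlus M a)),
                Kerr.radius a (Kerr.leafPoint (Kerr.cutoffHeight (σ M a) a R₁) τ y) ≤ R →
                  |(Kerr.smoothMetric M a (Kerr.rPlus M a)).unitNormalDeriv ψ
                      ⟨Kerr.leafPoint (Kerr.cutoffHeight (σ M a) a R₁) τ y, hy⟩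
                      (Kerr.leafNormal M a (Kerr.cutoffHeight (σ M a) a R₁)
                        ⟨Kerr.leafPoint (Kerr.cutoffHeight (σ M a) a R₁) τ y, hy⟩)| +
                    Real.sqrt ((Kerr.smoothMetric M a (Kerr.rPlus M a)).tangentialGradSq ψ
                      ⟨Kerr.leafPoint (Kerr.cutoffHeight (σ M a) a R₁) τ y, hy⟩
                      (Kerr.leafNormal M a (Kerr.cutoffHeight (σ M a) a R₁)
                        ⟨Kerr.leafPoint (Kerr.cutoffHeight (σ M a) a R₁) τ y, hy⟩)) ≤
                    C * τ ^ (-2 + δ)) :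
    drsr_wave_derivative_decay_kerr := by
  intro _ _ M a hMa ψ hψ δ hδ R
  obtain ⟨R₀, hR₀, hcor⟩ := h31 M a hMa
  -- a coordinate ball containing the support of the data
  obtain ⟨K, hK, hsupp⟩ := hψ.2.2
  obtain ⟨ρ, hρ, hKρ⟩ := exists_spatialNorm_le_of_isCompact hK
  set R₁ : ℝ := max R₀ (max ρ (R + 1)) with hR₁
  have hR₀₁ : R₀ ≤ R₁ := le_max_left _ _
  have hρ₁ : ρ ≤ R₁ := (le_max_left _ _).trans (le_max_right _ _)
  have hRR₁ : R < R₁ := (lt_add_one R).trans_le ((le_max_right _ _).trans (le_max_right _ _))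
  have hR₁nn : 0 ≤ R₁ := hR₀.le.trans hR₀₁
  -- the support hypothesis in ball form
  have hdata : Kerr.HasBallData M a R₁ ψ := by
    intro x hx0 hxR
    refine hsupp x hx0 fun hxK ↦ ?_
    have := hKρ x hxK
    linarith
  -- a radius bound `> r₊` for (31)
  set R' : ℝ := max R (Kerr.rPlus M a + 1) with hR'
  have hR'pos : Kerr.rPlus M a < R' := (lt_add_one _).trans_le (le_max_right _ _)
  obtain ⟨C, hC⟩ := hcor R₁ hR₀₁ ψ hψ hdata δ hδ R' hR'pos
  refine ⟨6 * C ^ 2, fun τ hτ y hy hyR ↦ ?_⟩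
  set h : E3 → ℝ := Kerr.cutoffHeight (σ M a) a R₁ with hh
  -- on `{‖y‖ ≤ R}` the leaf point is the slice point `(τ, y)` and the leaf normal is `V`
  have hlt : Kerr.radius a (E4.ofTimeSpace 0 y) < R₁ :=
    ((Kerr.radius_ofTimeSpace_le_norm a 0 y).trans hyR).trans_lt hRR₁
  have h0 : h y = 0 := Kerr.cutoffHeight_eq_zero_of_radius_le hR₁nn hlt.le
  have hpt : Kerr.leafPoint h τ y = E4.ofTimeSpace τ y := Kerr.leafPoint_of_eq_zero h0 τ
  have hy' : Kerr.leafPoint h τ y ∈ Kerr.region a (Kerr.rPlus M a) := by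
    rw [hpt]; exact hy
  have hrad : Kerr.radius a (Kerr.leafPoint h τ y) ≤ R' := by
    rw [hpt]
    exact ((Kerr.radius_ofTimeSpace_le_norm a τ y).trans hyR).trans (le_max_left _ _)
  have hbound := hC τ hτ y hy' hrad
  have hder : fderiv ℝ h (E4.spatial (Kerr.leafPoint h τ y)) = 0 := by
    rw [hpt, E4.spatial_ofTimeSpace]
    exact Kerr.fderiv_cutoffHeight_eq_zero hR₁nn hlt
  have hN : Kerr.leafNormal M a h ⟨Kerr.leafPoint h τ y, hy'⟩ =
      Kerr.timeVector M a (Kerr.leafPoint h τ y) :=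
    Kerr.leafNormal_eq_timeVector _ hder
  rw [hN] at hbound
  -- compare with the coordinate energy density at the slice point
  have hcmp :=
    Kerr.coordEnergyDensity_le_six_mul_sq_unitNormalDeriv_add_sqrt_tangentialGradSq hMa ψ hy'
  have h1 : coordEnergyDensity (Kerr.region a (Kerr.rPlus M a)) ψ (Kerr.leafPoint h τ y) ≤
      6 * (C * τ ^ (-2 + δ)) ^ 2 :=
    hcmp.trans (by gcongr)
  rw [hpt] at h1
  have hτ0 : 0 ≤ τ := zero_le_one.trans hτ
  have key : (τ ^ (-2 + δ)) ^ 2 = τ ^ (-4 + 2 * δ) := by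
    rw [← Real.rpow_two, ← Real.rpow_mul hτ0]
    congr 1
    ring
  calc coordEnergyDensity (Kerr.exterior M a) ψ (E4.ofTimeSpace τ y)
      ≤ 6 * (C * τ ^ (-2 + δ)) ^ 2 := h1
    _ = 6 * C ^ 2 * τ ^ (-4 + 2 * δ) := by rw [mul_pow, key]; ring

/-- **Reduction of DRSR's pointwise derivative decay (coordinate form) to Cor. 3.1 (31) through
the foliation `Σ̃_τ(h♯_{R₁})` terminating at `𝓘⁺`** (instance `σ = Kerr.scriSlope` of
`drsr_wave_derivative_decay_kerr_of_leaf_derivative_decay`; `Kerr.scriHeight M a R₁ =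
Kerr.cutoffHeight (Kerr.scriSlope M a) a R₁` definitionally). The hypothesis is the printed
estimate (31), `sup_{Σ̃_τ ∩ {r ≤ R}} |n_Σ̃ ψ| + |∇_Σ̃ ψ| ≤ C(a₀, M, δ, R) E τ^{-2+δ}`, for the
concrete hyperboloidal foliation `Σ̃_τ(h♯_{R₁}) = {t*_KS = τ + h♯_{R₁}(y)} = φ_τ Σ̃₀(h♯_{R₁})` of
`KerrHyperboloidalFlux.lean` (an admissible hypersurface of the second kind for `R₁ ≥ R₀(M, a)`,
equal to the Kerr–Schild slice on `{r ≤ R₁}`), in the vendored form of its companions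
`Kerr.drsr_corollary_3_1_scri_flux_decay` (first estimate) and
`Kerr.drsr_corollary_3_1_scri_pointwise_decay` ((30)): ball data `HasBallData M a R₁ ψ`,
`R₁ ≥ R₀`, every `δ > 0`, every `R > r₊`, an existential real constant `C(M, a, R₁, δ, R, ψ)`,
`τ ≥ 1`, exterior leaf points with `r ≤ R`, and the printed quantity `|n_Σ̃ ψ| + |∇_Σ̃ ψ|` rendered
by `unitNormalDeriv`/`tangentialGradSq` for the leaf normal `W = −g♯ d(t* − h♯_{R₁})`
(`Kerr.leafNormal`). This hypothesis is the interface a future named fact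
`Kerr.drsr_corollary_3_1_scri_derivative_decay` has to produce (module docstring). DRSR
arXiv:1402.7034, §3.3, Cor. 3.1 (31) and p. 51; Moschidis arXiv:1509.08489, §1.3.3. [cite: DafermosRodnianskiShlapentokhrothman2014, Cor. 3.1 (31) and p. 51] -/
theorem drsr_wave_derivative_decay_kerr_of_scri_leaf_derivative_decay
    (h31 : ∀ [Kerr.Facts] [Kerr.SliceFacts] (M a : ℝ), Kerr.IsSubextremal M a →
      ∃ R₀ : ℝ, 0 < R₀ ∧ ∀ R₁ : ℝ, R₀ ≤ R₁ →
        ∀ ψ : Kerr.region a (Kerr.rPlus M a) → ℝ, IsAdmissibleKerrWave M a ψ →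
          Kerr.HasBallData M a R₁ ψ → ∀ δ : ℝ, 0 < δ → ∀ R : ℝ, Kerr.rPlus M a < R →
            ∃ C : ℝ, ∀ τ : ℝ, 1 ≤ τ →
              ∀ (y : E3) (hy : Kerr.leafPoint (Kerr.scriHeight M a R₁) τ y ∈
                  Kerr.region a (Kerr.rPlus M a)),
                Kerr.radius a (Kerr.leafPoint (Kerr.scriHeight M a R₁) τ y) ≤ R →
                  |(Kerr.smoothMetric M a (Kerr.rPlus M a)).unitNormalDeriv ψ
                      ⟨Kerr.leafPoint (Kerr.scriHeight M a R₁) τ y, hy⟩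
                      (Kerr.leafNormal M a (Kerr.scriHeight M a R₁)
                        ⟨Kerr.leafPoint (Kerr.scriHeight M a R₁) τ y, hy⟩)| +
                    Real.sqrt ((Kerr.smoothMetric M a (Kerr.rPlus M a)).tangentialGradSq ψ
                      ⟨Kerr.leafPoint (Kerr.scriHeight M a R₁) τ y, hy⟩
                      (Kerr.leafNormal M a (Kerr.scriHeight M a R₁)
                        ⟨Kerr.leafPoint (Kerr.scriHeight M a R₁) τ y, hy⟩)) ≤
                    C * τ ^ (-2 + δ)) :
    drsr_wave_derivative_decay_kerr :=
  drsr_wave_derivative_decay_kerr_of_leaf_derivative_decay Kerr.scriSlope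
    fun M a hMa ↦ h31 M a hMa

/-- Corollary of the reduction: under (31) for the foliation `Σ̃_τ(h♯_{R₁})` the local coordinate
energy of `BlackHoles.lean` decays like `τ⁻²`
(`Literature.Geometry.Lorentzian.drsr_wave_polynomial_decay_kerr`, via
`drsr_wave_polynomial_decay_kerr_of_derivative_decay` of `KerrWaveDecay.lean`: integrate the
pointwise bound with `δ = 1` over the coordinate ball). DRSR arXiv:1402.7034, Cor. 3.1. [cite: DafermosRodnianskiShlapentokhrothman2014, Cor. 3.1 (31)] -/
theorem drsr_wave_polynomial_decay_kerr_of_scri_leaf_derivative_decay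
    (h31 : ∀ [Kerr.Facts] [Kerr.SliceFacts] (M a : ℝ), Kerr.IsSubextremal M a →
      ∃ R₀ : ℝ, 0 < R₀ ∧ ∀ R₁ : ℝ, R₀ ≤ R₁ →
        ∀ ψ : Kerr.region a (Kerr.rPlus M a) → ℝ, IsAdmissibleKerrWave M a ψ →
          Kerr.HasBallData M a R₁ ψ → ∀ δ : ℝ, 0 < δ → ∀ R : ℝ, Kerr.rPlus M a < R →
            ∃ C : ℝ, ∀ τ : ℝ, 1 ≤ τ →
              ∀ (y : E3) (hy : Kerr.leafPoint (Kerr.scriHeight M a R₁) τ y ∈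
                  Kerr.region a (Kerr.rPlus M a)),
                Kerr.radius a (Kerr.leafPoint (Kerr.scriHeight M a R₁) τ y) ≤ R →
                  |(Kerr.smoothMetric M a (Kerr.rPlus M a)).unitNormalDeriv ψ
                      ⟨Kerr.leafPoint (Kerr.scriHeight M a R₁) τ y, hy⟩
                      (Kerr.leafNormal M a (Kerr.scriHeight M a R₁)
                        ⟨Kerr.leafPoint (Kerr.scriHeight M a R₁) τ y, hy⟩)| +
                    Real.sqrt ((Kerr.smoothMetric M a (Kerr.rPlus M a)).tangentialGradSq ψ
                      ⟨Kerr.leafPoint (Kerr.scriHeight M a R₁) τ y, hy⟩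
                      (Kerr.leafNormal M a (Kerr.scriHeight M a R₁)
                        ⟨Kerr.leafPoint (Kerr.scriHeight M a R₁) τ y, hy⟩)) ≤
                    C * τ ^ (-2 + δ)) :
    drsr_wave_polynomial_decay_kerr :=
  drsr_wave_polynomial_decay_kerr_of_derivative_decay
    (drsr_wave_derivative_decay_kerr_of_scri_leaf_derivative_decay h31)

/-- Corollary of the reduction: under (31) for the foliation `Σ̃_τ(h♯_{R₁})` the local energy of
admissible waves tends to `0` (`Literature.Geometry.Lorentzian.drsr_wave_local_energy_decay_kerr`
of `BlackHoles.lean`, via `drsr_wave_local_energy_decay_kerr_of_derivative_decay` of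
`KerrWaveDecay.lean`). DRSR arXiv:1402.7034, Cor. 3.1. [cite: DafermosRodnianskiShlapentokhrothman2014, Cor. 3.1 (31)] -/
theorem drsr_wave_local_energy_decay_kerr_of_scri_leaf_derivative_decay
    (h31 : ∀ [Kerr.Facts] [Kerr.SliceFacts] (M a : ℝ), Kerr.IsSubextremal M a →
      ∃ R₀ : ℝ, 0 < R₀ ∧ ∀ R₁ : ℝ, R₀ ≤ R₁ →
        ∀ ψ : Kerr.region a (Kerr.rPlus M a) → ℝ, IsAdmissibleKerrWave M a ψ →
          Kerr.HasBallData M a R₁ ψ → ∀ δ : ℝ, 0 < δ → ∀ R : ℝ, Kerr.rPlus M a < R →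
            ∃ C : ℝ, ∀ τ : ℝ, 1 ≤ τ →
              ∀ (y : E3) (hy : Kerr.leafPoint (Kerr.scriHeight M a R₁) τ y ∈
                  Kerr.region a (Kerr.rPlus M a)),
                Kerr.radius a (Kerr.leafPoint (Kerr.scriHeight M a R₁) τ y) ≤ R →
                  |(Kerr.smoothMetric M a (Kerr.rPlus M a)).unitNormalDeriv ψ
                      ⟨Kerr.leafPoint (Kerr.scriHeight M a R₁) τ y, hy⟩
                      (Kerr.leafNormal M a (Kerr.scriHeight M a R₁)
                        ⟨Kerr.leafPoint (Kerr.scriHeight M a R₁) τ y, hy⟩)| +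
                    Real.sqrt ((Kerr.smoothMetric M a (Kerr.rPlus M a)).tangentialGradSq ψ
                      ⟨Kerr.leafPoint (Kerr.scriHeight M a R₁) τ y, hy⟩
                      (Kerr.leafNormal M a (Kerr.scriHeight M a R₁)
                        ⟨Kerr.leafPoint (Kerr.scriHeight M a R₁) τ y, hy⟩)) ≤
                    C * τ ^ (-2 + δ)) :
    drsr_wave_local_energy_decay_kerr :=
  drsr_wave_local_energy_decay_kerr_of_derivative_decay
    (drsr_wave_derivative_decay_kerr_of_scri_leaf_derivative_decay h31)

end Literature.Geometry.Lorentzian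

end
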